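import Summits.QuantumAdvantage.QuantumAdvantage.Theorems.WhiteBoxWalkWbwSearchToPromise
import Literature.Computability.Complexity.PromiseZPPProofs
import HarnessLib

/-!
# Crux `PromiseLift.PlLift` (stmt-QuantumAdvantage-0250), line `certified-canonical-lift` — stub `stub_canonical_lift`

Registered stub of the checked line skeleton `Cruxes/PlLift/Lines/certified_canonical_lift.lean`
(planner-cstrat-stmt-QuantumAdvantage-0250-0, sha `f97c9d33e600`), siege attempt k3
(variation: reduce to the landed lemmas of the crux chain, then assemble):

  `stub_canonical_lift : WbwCanonicalThesis → QuantumAdvantage`.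

The line's vocabulary `WbwCanonicalThesis` (X_pd, "planted unique-answer advantage with an
EVERYWHERE-CANONICAL quantum solver") lives only in the skeleton, which is not an importable module;
it is restated here as a `private` definition with a BYTE-IDENTICAL body (same device as the landed
sibling stub file `Theorems/PromiseLiftPlLiftStubCertifySiegeK1.lean`), so that the stub is proved by
name and signature.

## Proof (the LANGUAGE form of "pseudo-deterministic search reduces to a `BQP` decision problem",
Aaronson–Gur–Li, arXiv:2602.17647, Thm. 1.7; Goldreich 2006, §1.1)

Let `a` be the total canonical answer map (`|a x| = p(|x|)`, one uniform Clifford+T family writes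
`a x` first with probability `≥ 2/3` on EVERY `x`). The separating language is the bit language
`L = {z | bit |sndF z| of a (fstF z) is 1}`.

* `bitLang_mem_BQP` — `L ∈ BQP`: classical wrap (`mem_PromiseBQP_of_isQSolvable`, trivial promise
  `PromiseProblem.ofLanguage L`, `ofLanguage_mem_PromiseBQP_iff`) of the canonical family with
  pre-processor `fstF` and the TRUNCATING bit post-processor
  `⟨z, y⟩ ↦ [(y ↾ p|fstF z|)_{|sndF z|}]` (`bitPostT_apply`): on a good sample `y = a (fstF z) ++ w`
  the truncation is exactly `a (fstF z)`, so the output bit is the membership bit of `z` — also for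
  out-of-range indices, where it is `0` and `z ∉ L`. Bounded error holds on every string because
  `a` is total and canonical.
* `stub_canonical_lift` — `L ∉ BPP`: this is step 3 of the landed
  `Theorems/WhiteBoxWalkWbwSearchToPromise.lean` verbatim, with the hypothesis
  `PromiseBQP ⊆ PromiseBPP'` replaced by `ofLanguage_mem_PromiseBPP'_iff`: pull `ofLanguage L` back
  along `fstF`, amplify to error `1/(3p+1)` (`exists_amplifier_of_mem_PromiseBPP'`), answer the
  `p(|x|)` path queries `⟨x, a x ↾ k⟩` with ONE coin string (`AdBPPSim.accF`, union bound
  `uniformProb_accF_ne_le_third`, path lemma `bitLang_path`); the resulting PPT algorithm outputs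
  `a (gen s) = ans s` with probability `≥ 2/3` on every `(1ⁿ, gen s)`, so the uniform averages in the
  classical-hardness clause (C) are all `≥ 2/3`, contradicting superpolynomial decay (exponent `0`).

No new facts and no named-fact hypotheses; all plumbing is the tree's; axioms ⊆ {propext,
Classical.choice, Quot.sound}. In the skeleton the `sorry` of `stub_canonical_lift` becomes
`exact Summit.QuantumAdvantage.QuantumAdvantage.Theorems.PlLift.CertifiedCanonicalLift.SiegeK3.stub_canonical_lift`
(the private copy of `WbwCanonicalThesis` `δ`-unfolds to the skeleton's term, so the types agree
definitionally).
-/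

-- D-0017: single-problem summit ⇒ `QuantumAdvantage.QuantumAdvantage` by design.
set_option linter.dupNamespace false

namespace Summit.QuantumAdvantage.QuantumAdvantage.Theorems.PlLift.CertifiedCanonicalLift.SiegeK3

open _root_.Computability Literature.Computability.Complexity Literature.Computability.Cryptography
  Literature.Computability.QuantumComplexity Brick HashBricks Plumb AdBPPSim AdQuery Filter Polynomial
open Summit.QuantumAdvantage.QuantumAdvantage.Theorems.WhiteBoxWalk

/-! ### Vocabulary of the line (verbatim from the registered skeleton) -/

/-- **X_pd — planted unique-answer advantage with an EVERYWHERE-CANONICAL quantum solver.** As the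
route's `WbwThesis` (poly-time `gen`, answers `ans`, classical hardness (C) verbatim), but the quantum
clause is strengthened from "outputs `ans s` on input `gen s`" to: there is a total answer map `a` with
`a (gen s) = ans s`, `|a x| = p |x|`, and ONE uniform oracle-free Clifford+T family writes `a x` first
with probability `≥ 2/3` on EVERY input `x` (pseudo-deterministic everywhere, not only on the image of
`gen`). Verbatim the body of the registered statement `WbwCanonicalThesis` of the skeleton
`Cruxes/PlLift/Lines/certified_canonical_lift.lean` (sha `f97c9d33e600`): an obligation of the line
(hypothesis-grade, the antecedent of this stub), NOT a published fact — hence uncited and `private` (the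
public, registered copy is the skeleton's; this one only lets the registered signature of
`stub_canonical_lift` parse verbatim here, and `δ`-unfolds to the same term). Source of the notion:
Aaronson–Gur–Li, arXiv:2602.17647, Thm 1.7 (pseudo-deterministic quantum search ⇔ reducible to a `BQP`
decision LANGUAGE); Goldreich 2006, §1.1. -/
private def WbwCanonicalThesis : Prop :=
  ∃ (gen ans a : List Bool → List Bool) (p : Polynomial ℕ),
    Literature.Computability.Complexity.PolyTimeComputable id id gen ∧
    (∀ s, a (gen s) = ans s) ∧ (∀ x, (a x).length = p.eval x.length) ∧
    (∃ F : Literature.Computability.Cryptography.QCircuitFamily Literature.Computability.Cryptography.cliffordT,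
      F.IsOracleFree ∧ F.IsUniform ∧ ∀ x, 2 / 3 ≤ F.kernelProb 0 x {y | a x <+: y}) ∧
    ∀ A : Literature.Computability.Complexity.RandAlg (List Bool) (List Bool),
      Literature.Computability.Cryptography.IsPPT A id →
        Asymptotics.SuperpolynomialDecay atTop (fun n : ℕ => (n : ℝ)) (fun n : ℕ =>
          Literature.Computability.Cryptography.uniformAvg n fun s => A.pr id
            (Literature.Computability.Complexity.boolPair (Computability.unaryEncodeNat n) (gen s)) {y | ans s <+: y})

/-! ### The truncating bit post-processor and the bit language -/

/-- Value of the truncating bit post-processor `⟨z, y⟩ ↦ [(y ↾ p|fstF z|)_{|sndF z|}]` (bit `|sndF z|`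
of the first `p(|fstF z|)` symbols of `y`, default `0`), assembled from the tree's `FP` bricks.
[folklore] -/
theorem bitPostT_apply (p : Polynomial ℕ) (z y : List Bool) :
    (headBitFn ∘ dropFn ∘ fanoutFn (sndF ∘ fstF) (takeFn ∘ fanoutFn (polyFn p ∘ fstF ∘ fstF) sndF))
        (boolPair z y) = [(y.take (p.eval (fstF z).length))[(sndF z).length]?.getD false] := by
  simp [List.headD_eq_head?_getD, List.head?_drop]

/-- The truncating bit post-processor is polynomial-time. [folklore] -/
theorem bitPostT_mem_FP (p : Polynomial ℕ) :
    headBitFn ∘ dropFn ∘ fanoutFn (sndF ∘ fstF) (takeFn ∘ fanoutFn (polyFn p ∘ fstF ∘ fstF) sndF) ∈ FP :=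
  comp_mem_FP headBitFn_mem_FP (comp_mem_FP dropFn_mem_FP
    (fanoutFn_mem_FP (comp_mem_FP sndF_mem_FP fstF_mem_FP)
      (comp_mem_FP takeFn_mem_FP (fanoutFn_mem_FP
        (comp_mem_FP (polyFn_mem_FP p) (comp_mem_FP fstF_mem_FP fstF_mem_FP)) sndF_mem_FP))))

/-- **The bit language of an everywhere-canonical quantum search solver is in `BQP`.** If a total
map `a` with `|a x| = p(|x|)` is written first with probability `≥ 2/3` on EVERY input `x` by one
uniform oracle-free Clifford+T family, then `L = {z | (a (fstF z))_{|sndF z|} = 1}` is in `BQP`: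
wrap the family with pre-processor `fstF` and the truncating bit post-processor; on a good sample
`y = a (fstF z) ++ w` the output bit is the membership bit of `z` (out-of-range indices give `0`).
[cite: AaronsonGurLi2026, Thm 1.7] [cite: Watrous2009, §III.2] -/
theorem bitLang_mem_BQP {a : List Bool → List Bool} {p : Polynomial ℕ}
    (hlen : ∀ x, (a x).length = p.eval x.length) {F : QCircuitFamily cliffordT}
    (hF : F.IsOracleFree) (hU : F.IsUniform) (hQ : ∀ x, 2 / 3 ≤ F.kernelProb 0 x {y | a x <+: y})
    {L : Language Bool} (hL : ∀ z, z ∈ L ↔ (a (fstF z))[(sndF z).length]? = some true) :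
    L ∈ BQP := by
  have hR : IsQSolvable fun x => {y | a x <+: y} := ⟨F, hF, hU, hQ⟩
  -- on a good sample the truncation recovers the canonical answer
  have htake : ∀ z y, y ∈ (fun x => {y | a x <+: y}) (fstF z) →
      y.take (p.eval (fstF z).length) = a (fstF z) := by
    intro z y hy
    have hy' : a (fstF z) <+: y := hy
    rw [← hlen]
    exact (List.prefix_iff_eq_take.1 hy').symm
  refine ofLanguage_mem_PromiseBQP_iff.1 (mem_PromiseBQP_of_isQSolvable _ fstF _ fstF_mem_FP
    (bitPostT_mem_FP p) hR ?_ ?_)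
  · intro z hz y hy
    have hz' : z ∈ L := hz
    rw [bitPostT_apply, htake z y hy, (hL z).1 hz']
    exact List.prefix_rfl
  · intro z hz y hy
    have hzL : z ∉ L := hz
    have hz' : ¬ (a (fstF z))[(sndF z).length]? = some true := fun h => hzL ((hL z).2 h)
    rw [bitPostT_apply, htake z y hy]
    rcases h : (a (fstF z))[(sndF z).length]? with _ | b
    · exact List.prefix_rfl
    · cases b
      · exact List.prefix_rfl
      · exact absurd h hz'

/-- **The answer path lies in the bit language as it should**: `⟨x, a x ↾ k⟩ ∈ L` iff bit `k` of
`a x` is `1`, for `k < |a x|`. [folklore] -/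
theorem bitLang_path {a : List Bool → List Bool} {L : Language Bool}
    (hL : ∀ z, z ∈ L ↔ (a (fstF z))[(sndF z).length]? = some true) (x : List Bool) :
    ∀ k < (a x).length, (boolPair x ((a x).take k) ∈ L ↔ (a x)[k]? = some true) := by
  intro k hk
  rw [hL, fstF_boolPair, sndF_boolPair, List.length_take, min_eq_left hk.le]

/-! ### The stub -/

/-- **Stub `stub_canonical_lift` of line `certified-canonical-lift` (crux `PlLift`,
stmt-QuantumAdvantage-0250): an everywhere-canonical planted solver gives a `BQP ∖ BPP` LANGUAGE.**
`L = {z | (a (fstF z))_{|sndF z|} = 1}` is in `BQP` (`bitLang_mem_BQP`); if `L ∈ BPP`, then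
`ofLanguage L ∈ PromiseBPP'` (`ofLanguage_mem_PromiseBPP'_iff`), its pull-back along `fstF`
amplified to error `1/(3p(|x|)+1)` answers the `p(|x|)` path queries `⟨x, a x ↾ k⟩` correctly with
ONE coin string with probability `≥ 2/3` (`AdBPPSim.accF`, union bound), so a PPT algorithm outputs
`a (gen s) = ans s` on `(1ⁿ, gen s)` with probability `≥ 2/3` for EVERY `s`, and the uniform averages
in (C) are all `≥ 2/3` — not superpolynomially decaying (exponent `0`). Step 3 of
`wbwSearchToPromise_proof` verbatim at the language level.
[cite: AaronsonGurLi2026, Thm 1.7] [cite: Goldreich2006, §1.1] [cite: AroraBarak2009, §7.4.1] -/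
theorem stub_canonical_lift : WbwCanonicalThesis → QuantumAdvantage := by
  classical
  rintro ⟨gen, ans, a, p, -, hag, hlen, ⟨F, hF, hU, hFQ⟩, hC⟩
  show ∃ L : Language Bool, L ∈ BQP ∧ L ∉ BPP
  -- the bit language of the canonical answer map
  obtain ⟨L, hL⟩ : ∃ L : Language Bool, ∀ z, z ∈ L ↔ (a (fstF z))[(sndF z).length]? = some true :=
    ⟨{z | (a (fstF z))[(sndF z).length]? = some true}, fun _ => Iff.rfl⟩
  refine ⟨L, bitLang_mem_BQP hlen hF hU hFQ hL, fun hBPP => ?_⟩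
  have hY : ∀ x, ∀ k < (a x).length, (boolPair x ((a x).take k) ∈ L ↔ (a x)[k]? = some true) :=
    bitLang_path hL
  -- amplified deciders for the pulled-back (trivial-promise) problem
  have hQ' : (⟨{w | fstF w ∈ L}, {w | fstF w ∉ L}⟩ : PromiseProblem) ∈ PromiseBPP' :=
    PromiseProblem.mem_PromiseBPP'_of_polyTimeReducible_holds'
      ⟨fstF, fstF_mem_FP, fun w hw => hw, fun w hw => hw⟩ (ofLanguage_mem_PromiseBPP'_iff.2 hBPP)
  obtain ⟨B, hB, t, hyesB, hnoB, -⟩ :=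
    PromiseProblem.exists_amplifier_of_mem_PromiseBPP' hQ' (3 * p)
  -- per-query error of the path queries
  have herr : ∀ x, ∀ k < (a x).length,
      uniformProb (t.eval (padQ (boolPair x ((a x).take k))).length)
        {y | ¬ (boolPair (padQ (boolPair x ((a x).take k))) y ∈ B ↔
          boolPair x ((a x).take k) ∈ L)} ≤ 1 / (3 * (a x).length + 1) := by
    intro x k hk
    set q := boolPair x ((a x).take k) with hq
    have hbound : (1 : ℝ) / ((3 * p).eval (padQ q).length + 1) ≤ 1 / (3 * (a x).length + 1) := by
      have hmono : p.eval x.length ≤ p.eval (padQ q).length :=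
        TM2Iter.eval_mono p (by rw [length_padQ, hq, length_boolPair]; omega)
      have h3 : (3 * ((a x).length : ℝ) + 1) ≤ (3 * p).eval (padQ q).length + 1 := by
        rw [hlen x]
        have : (((3 * p).eval (padQ q).length : ℕ) : ℝ) = 3 * ((p.eval (padQ q).length : ℕ) : ℝ) := by
          have h3p : (3 * p).eval (padQ q).length = 3 * p.eval (padQ q).length := by simp
          rw [h3p]; push_cast; ring
        rw [this]
        have := (Nat.cast_le (α := ℝ)).2 hmono
        linarith
      exact one_div_le_one_div_of_le (by positivity) h3
    by_cases hqL : q ∈ L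
    · have hset : {y | ¬ (boolPair (padQ q) y ∈ B ↔ q ∈ L)} = {y | boolPair (padQ q) y ∉ B} := by
        ext y
        simp [hqL]
      rw [hset]
      exact (hyesB (padQ q) (show fstF (padQ q) ∈ L by simpa using hqL)).trans hbound
    · have hset : {y | ¬ (boolPair (padQ q) y ∈ B ↔ q ∈ L)} = {y | boolPair (padQ q) y ∈ B} := by
        ext y
        simp [hqL]
      rw [hset]
      exact (hnoB (padQ q) (show fstF (padQ q) ∉ L by simpa using hqL)).trans hbound
  -- the PPT algorithm answering all path queries with one coin string
  set T : Polynomial ℕ := t.comp (2 * (2 * X + 2 + p) + 3) with hTdef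
  have hFP : accF B t id p ∘ fanoutFn (sndF ∘ fstF) sndF ∈ FP :=
    comp_mem_FP (accF_mem_FP OracleCompose.id_mem_FP hB)
      (fanoutFn_mem_FP (comp_mem_FP sndF_mem_FP fstF_mem_FP) sndF_mem_FP)
  obtain ⟨A, hA, hArun, hAcoin⟩ : ∃ A : RandAlg (List Bool) (List Bool), IsPPT A id ∧
      (∀ u r, A.run u r = accF B t id p (boolPair (sndF u) r)) ∧ ∀ n, A.coinLen n = T.eval n :=
    ⟨⟨fun u r => accF B t id p (boolPair (sndF u) r), fun n => T.eval n⟩,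
      isPolyTime_of_FP (eb := id) hFP T (fun u r => by simp), fun _ _ => rfl, fun _ => rfl⟩
  -- success on every seed: the output is the canonical answer `a (gen s) = ans s`
  have hs : ∀ n s, (2 : ℝ) / 3 ≤ A.pr id (boolPair (unaryEncodeNat n) (gen s)) {y | ans s <+: y} := by
    intro n s
    rw [← hag s]
    refine pr_ge_of_uniformProb_ne_le (a := a (gen s)) List.prefix_rfl ?_
    have hrun : {r | A.run (boolPair (unaryEncodeNat n) (gen s)) r ≠ a (gen s)} =
        {r | accF B t id p (boolPair (gen s) r) ≠ a (gen s)} := by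
      ext r
      rw [Set.mem_setOf_eq, Set.mem_setOf_eq, hArun, sndF_boolPair]
    rw [hrun, hAcoin]
    refine uniformProb_accF_ne_le_third (Y := L) (a (gen s)) (gen s) (hlen (gen s)).symm (hY (gen s))
      (herr (gen s)) fun k hk => ?_
    rw [hTdef, eval_comp]
    refine TM2Iter.eval_mono t ?_
    have h1 : (padQ (boolPair (gen s) ((a (gen s)).take k))).length ≤
        2 * (2 * (gen s).length + 2 + (a (gen s)).length) + 3 := by
      rw [length_padQ, length_boolPair, List.length_take]
      omega
    have h2 : (gen s).length ≤ (boolPair (unaryEncodeNat n) (gen s)).length := by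
      rw [length_boolPair]; omega
    have h3 : (a (gen s)).length ≤ p.eval (boolPair (unaryEncodeNat n) (gen s)).length := by
      rw [hlen]; exact TM2Iter.eval_mono p h2
    have h4 : (2 * (2 * X + 2 + p) + 3 : Polynomial ℕ).eval (boolPair (unaryEncodeNat n) (gen s)).length =
        2 * (2 * (boolPair (unaryEncodeNat n) (gen s)).length + 2 +
          p.eval (boolPair (unaryEncodeNat n) (gen s)).length) + 3 := by
      simp
    rw [h4]
    omega
  have havg : ∀ n, (2 : ℝ) / 3 ≤
      uniformAvg n (fun s => A.pr id (boolPair (unaryEncodeNat n) (gen s)) {y | ans s <+: y}) :=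
    fun n => le_uniformAvg fun s => hs n s
  -- contradiction with superpolynomial decay at exponent `0`
  have h0 := hC A hA 0
  simp only [pow_zero, one_mul] at h0
  obtain ⟨n, hn⟩ := (h0.eventually (Iio_mem_nhds (show (0 : ℝ) < 2 / 3 by norm_num))).exists
  exact absurd (havg n) (not_le.2 hn)

end Summit.QuantumAdvantage.QuantumAdvantage.Theorems.PlLift.CertifiedCanonicalLift.SiegeK3
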